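import Mathlib.NumberTheory.Real.Irrational
import Literature.NumberTheory.EllipticCurves.TwoIsogenyShaTwoTorsion
import Literature.NumberTheory.EllipticCurves.TwoIsogenyDescentIndex
import Literature.NumberTheory.EllipticCurves.TwoIsogenySelmerGroupRankProofs
import Literature.NumberTheory.EllipticCurves.BinaryQuarticLocalSolubility
import Literature.NumberTheory.EllipticCurves.BSDInvariants
import Literature.NumberTheory.EllipticCurves.RegulatorProofs
import Literature.NumberTheory.EllipticCurves.MordellWeilRankZeroProofs
import Literature.NumberTheory.EllipticCurves.SkinnerUrban2014.PAdicUnitPeriodRatioAnyPrimeProofs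
import Literature.NumberTheory.EllipticCurves.ComplexMultiplicationBurungaleFlachProofs
import Literature.NumberTheory.EllipticCurves.LeadingTermPPartProofs
import Literature.NumberTheory.EllipticCurves.AnalyticRankOrderProofs
import Literature.NumberTheory.EllipticCurves.CuspFormLFunctionAnalyticRankProofs
import Summits.BirchSwinnertonDyer.Rank1Residual.ManinAdditive.ShimuraLedger
import Summits.BirchSwinnertonDyer.BirchSwinnertonDyer.Theorems.ManinLocalTwoThreeBlindFamilyTwoDescent
import HarnessLib
import HarnessLib.Audit.Tags

/-!
# BSD₂ ON THE BLIND FAMILIES: the `2`-adic content of the leading-term formula, the cusp criterion, and the typed rows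
# E-an-102 / 103 / 103♯ / 103♭ (an g23, MEMO-an §65 (B)–(E); cell `bsd-f2-manin`, typing ask T-an-29; typer g13)

HONEST FRAMING.  LENS = analytic / descent (`bsd-f2-manin-an` g23).  SOURCE = HOME/an/Sketch-an-g23.lean 400c28f5dc912b9f
§7 «Part C / §BSDTwo» (l. 501–833; farm rc 0 · 0 sorries · axioms standard), VERBATIM up to (i) the `@[conjecture]` tags and
honest-framing sentences on the four rows and (ii) the OMISSION of the six declarations already ported by the C2/C3 LEAD
(bsd-line-manin23-p1 g5) into `…Theorems.ManinLocalTwoThree.BlindFamilyDescent` (`not_two_dvd_shaOrder_of_sha_two`,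
`isElliptic_blindCurve`, `finite_point_blindCurve`, `regulator_blindCurve`, `not_two_dvd_shaOrder_blindCurve`, and Parts A/B:
`Theorems/ManinLocalTwoThreeBlindFamilyTwoDescent{,Selmer}.lean`, route-independent imports) — used here BY NAME through
`open`.  SETTING: the `X₀`-optimal BLIND curve `E′_m = ShimuraLedger.blindCurve m : y² = x³ − 2m x² + (m² + 4) x`, `m` odd,
`p = m² + 4` prime (`N = 4p` tame / `16p` wild); Parts A/B (lead's port): `rank E′_m(ℚ) = 0`, `Ш(E′_m)[2] = 0`, `Reg = 1`.
CONTENTS (PROVED unless tagged): `BSDTwoAdicLead W` (`BSD₂(W)`: `b·L^{(r)}(W,1)/r!·#tors² = a·#Ш·Reg·Ω·∏c`, `a, b` odd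
NATURALS — REF1 §R68 H-1: the ℕ-witnesses also assert the SIGN «leading coefficient ≥ 0» [Guo 1996, Duke 83]; an's repair
choice (α) ℤ-witness / (β) cite is open — this file keeps the sketch's text (β-compatible, same convention as the landed es
rows E-es-54/55)), `bsdTwoAdicLead_of_lead` (LEAD ⇒ BSD₂), `bsdTwoAdicLead_iff_halfUnit`, the three parity transfers,
**E-an-104 `blindCurve_bsdTwo_iff_halfUnit`** (E-es-54 ⟺ BSD₂(E′_m) given `#tors = 2`, `∏c = 2c₂` odd), **E-an-105
`blindCurve_maninOdd_iff_cuspHalf_of_bsdTwo`** (the CUSP CRITERION: mod BSD₂ + local terms, `2 ∤ c ⟺ v₂([0]⁺_f) = −1`),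
`blindCurve_bsdTwo_of_maninOdd_of_cuspHalf` (C2 ∧ E-es-55 ⟹ BSD₂), the L-link `leadingLCoeff_eq_modularSymbol_zero` and the
`ratPlusSymbol` forms; ROWS (`@[conjecture]`, nothing asserted): **E-an-102 `BlindFamilyBSDTwo`** (LAW = BSD₂ on the family in
analytic rank 0; entails Ш-finite & L > 0, H-1/H-2), **E-an-103 `BlindFamilyLocalTerms`**, **E-an-103♯ `BlindFamilyTamagawaLaw`**,
**E-an-103♭ `BlindFamilyTorsionLaw`** (PAPER THEOREMS — Tate at 2 / p, Lutz–Nagell; theorem targets).  BC5 WITNESS: census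
g23 (kit j309044, HOME/an/g23/census-g23.md d6f857e68ffe87d4): 2 708 members, 0 violations of 13 laws; `v₂(L(E′_m,1)/ω₁) = −1`
2 708/2 708; REF1 ENGINE T 8 166/8 166 + 15 400 members to |m| ≤ 120 001 for the local laws.  REFUTER VERDICTS: REF1 §R68
(R-an-41, HOME/ref1/R68-ref1-an-g23.md): E-an-102 SURVIVES (LAW), 103/103♯/103♭ SURVIVE (paper theorems), 104/105 + family edges
PROVED (39/39 closures standard), Part A FAITHFUL, BC7 summit 7/7 CLEAN, 0 killed; REF2 R-an-42 pending (placement vs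
Stein–Watkins / Ivorra 2004).  Part D (THEOREM D, E-an-106/106♭/106♯) is the sibling `BlindFamilyOddDegreeBSDTwo`.
bears_on: stmt-BirchSwinnertonDyer-22967 (C2 `ManinOddAtFour`, stub 6d/6e — the blind residual: C2 ⟺_{BSD₂} E-es-55).
PARTITION 0 · beyond-print theorem: YES in the weak sense for Parts A/B (lead's port), no for this file (bookkeeping + rows) ·
BSD is not proved by this; Manin's conjecture is not proved by this.
-/

set_option autoImplicit false

noncomputable section

open scoped Classical

namespace Summit.BirchSwinnertonDyer.Rank1Residual.ManinAdditive.BlindFamilyDescent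

open _root_.WeierstrassCurve _root_.WeierstrassCurve.Affine
open Literature.NumberTheory.EllipticCurves Literature.NumberTheory.DiophantineGeometry
open Summit.BirchSwinnertonDyer.Rank1Residual.ManinAdditive.ShimuraLedger (blindCurve sourceCurve)
open Summit.BirchSwinnertonDyer.BirchSwinnertonDyer.Theorems.ManinLocalTwoThree.BlindFamilyDescent

/-! ## 7. Consequences for the `2`-part of BSD on the family (MEMO-an §65 (B)–(D))

`BSD₂(W)` below is the `2`-adic content of LEAD in the rank-`0` shape: `L(W,1)·#E(ℚ)_tors² /
(#Ш · Reg · Ω · ∏ c_ℓ)` is a `2`-adic unit (`odd / odd`).  On the blind family the `Ш`-term and the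
regulator are now THEOREMS (`Ш[2] = 0` ⇒ `#Ш` odd once finite; `rank = 0` ⇒ `Reg = 1`, `E(ℚ)` finite), so
es's law E-es-54 `SourceFamilyLValueHalfUnit` (`2b·L(E'_m,1) = a·Ω(E'_m)`, `a,b` odd) is EXACTLY `BSD₂(E'_m)`
modulo the two routine local terms `#E'_m(ℚ) = 2` (Lutz–Nagell) and `∏ c_ℓ = 2·c₂`, `c₂` odd (Tate; `c_p = 2`
at the `I₂` prime `p`, `c₂ ∈ {1,3}` at IV*, `c₂ = 1` observed at I₀*) — both `100 %` in the g23 census and typed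
as the support candidate `BlindFamilyLocalTerms`.  The TRIANGLE of §65 (any two of: cusp law E-es-55,
Manin parity C2, BSD₂) is the three one-line transfers below (es's LEVER-es-29 is the third). -/

section BSDTwo

open Literature.NumberTheory.EllipticCurves.ModularForms

/-- Products of odd naturals are odd. [folklore] -/
theorem not_two_dvd_mul {x y : ℕ} (hx : ¬ 2 ∣ x) (hy : ¬ 2 ∣ y) : ¬ 2 ∣ x * y := fun h =>
  ((Nat.Prime.dvd_mul Nat.prime_two).mp h).elim hx hy

/-- `2 ∣ |c| ↔ 2 ∣ c`. [folklore] -/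
theorem two_dvd_natAbs_iff (c : ℤ) : 2 ∣ c.natAbs ↔ (2 : ℤ) ∣ c := by
  rw [← Int.natAbs_dvd_natAbs]; norm_num

/-- **`BSD₂(W)`** — the `2`-adic part of the BSD leading-term formula in the rank-`0` shape:
`b · L^{(r)}(W,1)/r! · #E(ℚ)_tors² = a · #Ш · Reg · Ω · ∏ c_ℓ` with `a, b` odd.  (For `W` globally minimal;
`LEAD ⇒ BSD₂` with `a = b = 1`, `bsdTwoAdicLead_of_lead`.) [cite: Tate1974, Conjecture 4(b) (2-adic valuation of)] -/
def BSDTwoAdicLead (W : WeierstrassCurve ℚ) : Prop :=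
  ∃ a b : ℕ, ¬ 2 ∣ a ∧ ¬ 2 ∣ b ∧
    (b : ℂ) * W.leadingLCoeff * (W.torsionOrder : ℂ) ^ 2 =
      (a : ℂ) * (W.shaOrder : ℂ) * (W.regulator : ℂ) * (W.realPeriodRat : ℂ) * (W.tamagawaProduct : ℂ)

/-- `LEAD ⇒ BSD₂` (with `a = b = 1`), for `#E(ℚ)_tors ≠ 0`. [cite: Tate1974, Conjecture 4(b)] -/
theorem bsdTwoAdicLead_of_lead (W : WeierstrassCurve ℚ) (hL : W.BSDLeadingTermFormula)
    (ht : W.torsionOrder ≠ 0) : BSDTwoAdicLead W := by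
  refine ⟨1, 1, by norm_num, by norm_num, ?_⟩
  have hL' : W.leadingLCoeff = (W.bsdRHS : ℂ) := hL
  have ht' : (W.torsionOrder : ℂ) ≠ 0 := by exact_mod_cast ht
  rw [hL', bsdRHS_def]
  push_cast
  field_simp

/-- **Parity transfer I (PROVED): `BSD₂ ⟺ E-es-54-shape`** given `#Ш` odd, `Reg = 1`, `#E(ℚ)_tors = 2`,
`∏ c_ℓ = 2·c₂` with `c₂` odd:  `b L · 4 = a Ш Ω 2c₂ ⟺ 2 b' L = a' Ω` (move the odd factors `Ш, c₂`). [folklore] -/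
theorem bsdTwoAdicLead_iff_halfUnit (W : WeierstrassCurve ℚ) (hSha : ¬ 2 ∣ W.shaOrder)
    (hReg : W.regulator = 1) (htors : W.torsionOrder = 2) (c₂ : ℕ) (hc₂ : ¬ 2 ∣ c₂)
    (hT : W.tamagawaProduct = 2 * c₂) :
    BSDTwoAdicLead W ↔
      ∃ a b : ℕ, ¬ 2 ∣ a ∧ ¬ 2 ∣ b ∧ 2 * (b : ℂ) * W.leadingLCoeff = (a : ℂ) * (W.realPeriodRat : ℂ) := by
  constructor
  · rintro ⟨a, b, ha, hb, h⟩
    refine ⟨a * W.shaOrder * c₂, b, not_two_dvd_mul (not_two_dvd_mul ha hSha) hc₂, hb, ?_⟩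
    rw [htors, hReg, hT] at h
    push_cast at h ⊢
    linear_combination (1 / 2 : ℂ) * h
  · rintro ⟨a, b, ha, hb, h⟩
    refine ⟨a, b * W.shaOrder * c₂, ha, not_two_dvd_mul (not_two_dvd_mul hb hSha) hc₂, ?_⟩
    rw [htors, hReg, hT]
    push_cast
    linear_combination (2 * (W.shaOrder : ℂ) * (c₂ : ℂ)) * h

/-- **Parity transfer II (PROVED):** `k` odd and `2bℓ = aΩ⁺` (`a,b` odd) ⇒ `2b'ℓ = a'Ω` for `Ω = k·Ω⁺`. [folklore] -/
theorem halfUnit_period_of_halfUnit_plusPeriod (ℓ : ℂ) (Ω Ωp : ℝ) (k : ℕ) (hk : ¬ 2 ∣ k)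
    (hΩ : Ω = (k : ℝ) * Ωp)
    (h : ∃ a b : ℕ, ¬ 2 ∣ a ∧ ¬ 2 ∣ b ∧ 2 * (b : ℂ) * ℓ = (a : ℂ) * (Ωp : ℂ)) :
    ∃ a b : ℕ, ¬ 2 ∣ a ∧ ¬ 2 ∣ b ∧ 2 * (b : ℂ) * ℓ = (a : ℂ) * (Ω : ℂ) := by
  obtain ⟨a, b, ha, hb, e⟩ := h
  refine ⟨a, b * k, ha, not_two_dvd_mul hb hk, ?_⟩
  rw [hΩ]
  push_cast
  linear_combination (k : ℂ) * e

/-- **Parity transfer III (PROVED):** `k` odd, `Ω = k·Ω⁺` and `2bℓ = aΩ` (`a,b` odd) ⇒ `2b'ℓ = a'Ω⁺`. [folklore] -/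
theorem halfUnit_plusPeriod_of_halfUnit_period (ℓ : ℂ) (Ω Ωp : ℝ) (k : ℕ) (hk : ¬ 2 ∣ k)
    (hΩ : Ω = (k : ℝ) * Ωp)
    (h : ∃ a b : ℕ, ¬ 2 ∣ a ∧ ¬ 2 ∣ b ∧ 2 * (b : ℂ) * ℓ = (a : ℂ) * (Ω : ℂ)) :
    ∃ a b : ℕ, ¬ 2 ∣ a ∧ ¬ 2 ∣ b ∧ 2 * (b : ℂ) * ℓ = (a : ℂ) * (Ωp : ℂ) := by
  obtain ⟨a, b, ha, hb, e⟩ := h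
  refine ⟨a * k, b, not_two_dvd_mul ha hk, hb, ?_⟩
  rw [hΩ] at e
  push_cast at e ⊢
  linear_combination e

/-- **Parity transfer IV (PROVED; es's LEVER-es-29):** `Ω = k·Ω⁺`, `Ω⁺ ≠ 0`, `2b₁ℓ = a₁Ω` and `2b₂ℓ = a₂Ω⁺`
(all odd) ⇒ `k` odd. [folklore] -/
theorem not_two_dvd_of_halfUnit_period_of_halfUnit_plusPeriod (ℓ : ℂ) (Ω Ωp : ℝ) (k : ℕ)
    (hΩ : Ω = (k : ℝ) * Ωp) (hpos : Ωp ≠ 0)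
    (h₁ : ∃ a b : ℕ, ¬ 2 ∣ a ∧ ¬ 2 ∣ b ∧ 2 * (b : ℂ) * ℓ = (a : ℂ) * (Ω : ℂ))
    (h₂ : ∃ a b : ℕ, ¬ 2 ∣ a ∧ ¬ 2 ∣ b ∧ 2 * (b : ℂ) * ℓ = (a : ℂ) * (Ωp : ℂ)) : ¬ 2 ∣ k := by
  obtain ⟨a₁, b₁, ha₁, hb₁, e₁⟩ := h₁
  obtain ⟨a₂, b₂, ha₂, hb₂, e₂⟩ := h₂
  rw [hΩ] at e₁
  push_cast at e₁
  have key : ((b₂ * a₁ * k : ℕ) : ℂ) * (Ωp : ℂ) = ((b₁ * a₂ : ℕ) : ℂ) * (Ωp : ℂ) := by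
    push_cast
    linear_combination (-(b₂ : ℂ)) * e₁ + (b₁ : ℂ) * e₂
  have hk0 : (Ωp : ℂ) ≠ 0 := by exact_mod_cast hpos
  have keyN : b₂ * a₁ * k = b₁ * a₂ := by exact_mod_cast mul_right_cancel₀ hk0 key
  intro h2k
  have : 2 ∣ b₁ * a₂ := keyN ▸ Dvd.dvd.mul_left h2k _
  exact ((Nat.Prime.dvd_mul Nat.prime_two).mp this).elim hb₁ ha₂

variable {m : ℤ} {p : ℕ} [hp : Fact p.Prime]

/-- **THEOREM (an g23): on the blind family, `BSD₂(E'_m) ⟺ E-es-54`**, the `Ш`- and `Reg`-terms being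
discharged by the descent; the remaining hypotheses are the two routine local terms. [folklore] -/
theorem blindCurve_bsdTwo_iff_halfUnit (hpm : (p : ℤ) = m ^ 2 + 4) (hm : Odd m)
    [Finite (blindCurve m).sha] (htors : (blindCurve m).torsionOrder = 2) (c₂ : ℕ) (hc₂ : ¬ 2 ∣ c₂)
    (hT : (blindCurve m).tamagawaProduct = 2 * c₂) :
    BSDTwoAdicLead (blindCurve m) ↔
      ∃ a b : ℕ, ¬ 2 ∣ a ∧ ¬ 2 ∣ b ∧
        2 * (b : ℂ) * (blindCurve m).leadingLCoeff = (a : ℂ) * ((blindCurve m).realPeriodRat : ℂ) :=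
  bsdTwoAdicLead_iff_halfUnit _ (not_two_dvd_shaOrder_blindCurve hpm hm) (regulator_blindCurve hpm hm)
    htors c₂ hc₂ hT

/-- **CUSP CRITERION (an g23; PROVED edge).**  On the blind family, given `BSD₂(E'_m)` and the two local
terms, for a lattice-optimal datum `D` (`Λ_E = c·Λ_f`) with the modularity link `L(E'_m,1) = {∞,0}_{D.f}`:
`c` is ODD iff the cusp symbol is a HALF-unit, `2b·{∞,0}_f = a·Ω⁺_f` (`a,b` odd) — i.e. iff `φ(0) = T`.
So, modulo BSD₂, the invariant controlling `ord₂(c)` on this additive family is the image of the cusp `0`.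
[cite: CremonaAlgorithms1997, §2.8 (p. 26)] -/
theorem blindCurve_maninOdd_iff_cuspHalf_of_bsdTwo (hpm : (p : ℤ) = m ^ 2 + 4) (hm : Odd m)
    [Finite (blindCurve m).sha] (htors : (blindCurve m).torsionOrder = 2) (c₂ : ℕ) (hc₂ : ¬ 2 ∣ c₂)
    (hT : (blindCurve m).tamagawaProduct = 2 * c₂) (hbsd : BSDTwoAdicLead (blindCurve m))
    {N : ℕ} [NeZero N] (D : ModularParametrizationData (blindCurve m) N)
    (hopt : ∀ z ∈ D.L.lattice, ∃ w ∈ periodLattice D.f, z = D.c * w)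
    (hlink : (blindCurve m).leadingLCoeff = modularSymbol D.f 0) :
    ¬ (2 : ℤ) ∣ D.c ↔
      ∃ a b : ℕ, ¬ 2 ∣ a ∧ ¬ 2 ∣ b ∧ 2 * (b : ℂ) * modularSymbol D.f 0 = (a : ℂ) * (plusPeriod D.f : ℂ) := by
  haveI := isElliptic_blindCurve hpm
  have hγ := (blindCurve_bsdTwo_iff_halfUnit hpm hm htors c₂ hc₂ hT).mp hbsd
  rw [hlink] at hγ
  have habs : ((D.c.natAbs : ℕ) : ℝ) = |(D.c : ℝ)| := by
    rw [← Int.cast_natCast, Int.natCast_natAbs, Int.cast_abs]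
  have hΩ : (blindCurve m).realPeriodRat = ((D.c.natAbs : ℕ) : ℝ) * plusPeriod D.f := by
    rw [habs]; exact D.realPeriodRat_eq_abs_mul_plusPeriod_of_latticeEq hopt
  have hpos : (plusPeriod D.f : ℝ) ≠ 0 := by
    have h0 : 0 < (blindCurve m).realPeriodRat := (blindCurve m).realPeriodRat_pos_holds
    intro h; rw [h, mul_zero] at hΩ; exact (ne_of_gt h0) hΩ
  rw [← two_dvd_natAbs_iff]
  constructor
  · intro hodd
    exact halfUnit_plusPeriod_of_halfUnit_period _ _ _ _ hodd hΩ hγ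
  · intro hα
    exact not_two_dvd_of_halfUnit_period_of_halfUnit_plusPeriod _ _ _ _ hΩ hpos hγ hα

/-- **Parity transfer, assembled the other way (PROVED edge): Manin-odd ∧ cusp-half ⇒ E-es-54-shape**, hence
(with the local terms) `BSD₂(E'_m)` — the cell's C2 and the `c`-free cusp law together PROVE the `2`-part of
BSD on the family. [folklore] -/
theorem blindCurve_bsdTwo_of_maninOdd_of_cuspHalf (hpm : (p : ℤ) = m ^ 2 + 4) (hm : Odd m)
    [Finite (blindCurve m).sha] (htors : (blindCurve m).torsionOrder = 2) (c₂ : ℕ) (hc₂ : ¬ 2 ∣ c₂)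
    (hT : (blindCurve m).tamagawaProduct = 2 * c₂)
    {N : ℕ} [NeZero N] (D : ModularParametrizationData (blindCurve m) N)
    (hopt : ∀ z ∈ D.L.lattice, ∃ w ∈ periodLattice D.f, z = D.c * w)
    (hlink : (blindCurve m).leadingLCoeff = modularSymbol D.f 0) (hodd : ¬ (2 : ℤ) ∣ D.c)
    (hα : ∃ a b : ℕ, ¬ 2 ∣ a ∧ ¬ 2 ∣ b ∧ 2 * (b : ℂ) * modularSymbol D.f 0 = (a : ℂ) * (plusPeriod D.f : ℂ)) :
    BSDTwoAdicLead (blindCurve m) := by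
  haveI := isElliptic_blindCurve hpm
  have habs : ((D.c.natAbs : ℕ) : ℝ) = |(D.c : ℝ)| := by
    rw [← Int.cast_natCast, Int.natCast_natAbs, Int.cast_abs]
  have hΩ : (blindCurve m).realPeriodRat = ((D.c.natAbs : ℕ) : ℝ) * plusPeriod D.f := by
    rw [habs]; exact D.realPeriodRat_eq_abs_mul_plusPeriod_of_latticeEq hopt
  rw [← two_dvd_natAbs_iff] at hodd
  refine (blindCurve_bsdTwo_iff_halfUnit hpm hm htors c₂ hc₂ hT).mpr ?_
  rw [hlink]
  exact halfUnit_period_of_halfUnit_plusPeriod _ _ _ _ hodd hΩ hα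

/-! ### Typed candidates (MEMO-an §65 (E)) -/

/-- **E-an-102 `BlindFamilyBSDTwo`** (CANDIDATE LAW, typed = the `2`-part of BSD-LEAD on the blind family
`E'_m`; census g23 (kit j309044): `v₂(L/ω₁) = −1`, `Ш_an` an odd square, `c₂` odd, `#tors = 2` for every odd
`3 ≤ |m| ≤ 8353` with `m² + 4` prime (1485 curves, 0 exceptions) — BC5 witness; ⟺ E-es-54 by
`blindCurve_bsdTwo_iff_halfUnit` + `BlindFamilyLocalTerms`).  Why it might fail: it is BSD₂ for an infinite
non-CM family with additive reduction at `2` — no known method (Kato / Skinner–Urban give odd `p`; the `2`-adic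
results in print are CM or quadratic-twist families).
Cell bsd-f2-manin row E-an-102 (LAW = BSD₂ on the family; REF1 §R68 R-an-41: SURVIVES; HIDDEN CONTENT H-1/H-2 recorded there: as typed it entails «analyticRank 0 ⇒ Ш(E′_m) finite» through the `shaOrder` junk value and «L(E′_m,1) > 0» through the ℕ-witnesses — both TRUE in print (Kolyvagin 1990 + BCDT; Guo 1996), absent from the tree).  Typed VERBATIM from HOME/an/Sketch-an-g23.lean 400c28f5dc912b9f (typer g13, T-an-29); nothing asserted.
[conjecture — cell candidate, NOT a tree fact] -/
@[conjecture]
def BlindFamilyBSDTwo : Prop :=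
  ∀ m : ℤ, Odd m → Nat.Prime (m ^ 2 + 4).natAbs → (blindCurve m).analyticRank = 0 →
    BSDTwoAdicLead (blindCurve m)

/-- **E-an-103 `BlindFamilyLocalTerms`** (SUPPORT candidate, routine: Lutz–Nagell + Tate's algorithm; census g23
1485/1485): for odd `|m| ≥ 3` with `m² + 4` prime, `#E'_m(ℚ) = 2` and `∏ c_ℓ(E'_m) = 2·c₂` with `c₂` odd
(`c_p = 2` at the `I₂` prime `p = m² + 4`).  Why it might fail: only by a slip in the local bookkeeping
(`m = ±1`: `N = 20` has `#E(ℚ) = 6`, `N = 80` has `2`).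
Cell bsd-f2-manin row E-an-103 (SUPPORT; PAPER THEOREM — Tate at 2 and p, Lutz–Nagell; REF1 §R68: SURVIVES, ENGINE T 8 166/8 166 + 15 400 members; a typing candidate = theorem target, filed as an open tree obligation until formalized); nothing asserted.
[conjecture — theorem on paper, NOT yet a tree theorem] -/
@[conjecture]
def BlindFamilyLocalTerms : Prop :=
  ∀ m : ℤ, Odd m → 3 ≤ |m| → Nat.Prime (m ^ 2 + 4).natAbs →
    (blindCurve m).torsionOrder = 2 ∧ ∃ c₂ : ℕ, ¬ 2 ∣ c₂ ∧ (blindCurve m).tamagawaProduct = 2 * c₂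

/-- **E-an-103♯ `BlindFamilyTamagawaLaw`** (sharp local law read off census g23, 1485/1485, two Kodaira cells):
`∏_ℓ c_ℓ(E'_m) = c₂ · c_p` with `c_p = 2` (`I₂`) and `c₂ = 3` if `m ≡ 1 (mod 8)` (IV*, split), `c₂ = 1` if
`m ≡ 5 (mod 8)` (IV*, non-split) or `m ≡ 3 (mod 4)` (I₀*).  Routine (Tate's algorithm on `[0,−2m,0,m²+4,0]`).
Cell bsd-f2-manin row E-an-103♯ (PAPER THEOREM, true also at m = ±1 — REF1 §R68 H-3; `m % 8` is `Int.emod`, so for negative m the cells are the arithmetic ones); theorem target; nothing asserted.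
[conjecture — theorem on paper, NOT yet a tree theorem] -/
@[conjecture]
def BlindFamilyTamagawaLaw : Prop :=
  ∀ m : ℤ, Odd m → Nat.Prime (m ^ 2 + 4).natAbs →
    (blindCurve m).tamagawaProduct = 2 * (if m % 8 = 1 then 3 else 1)

/-- **E-an-103♭ `BlindFamilyTorsionLaw`**: `E'_m(ℚ) = {O, (0,0)}` for odd `|m| ≥ 3`, `m² + 4` prime (rank `0` is
the theorem `mordellWeilRank_blindCurve_eq_zero`; torsion `= ℤ/2` is Lutz–Nagell; census 1485/1485).
Cell bsd-f2-manin row E-an-103♭ (PAPER THEOREM; REF1 §R68: SURVIVES); theorem target; nothing asserted.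
[conjecture — theorem on paper, NOT yet a tree theorem] -/
@[conjecture]
def BlindFamilyTorsionLaw : Prop :=
  ∀ m : ℤ, Odd m → 3 ≤ |m| → Nat.Prime (m ^ 2 + 4).natAbs → (blindCurve m).torsionOrder = 2

/-- The two sharp laws give the support candidate. [folklore] -/
theorem blindFamilyLocalTerms_of_laws (h₁ : BlindFamilyTorsionLaw) (h₂ : BlindFamilyTamagawaLaw) :
    BlindFamilyLocalTerms := by
  intro n hn h3 hprime
  refine ⟨h₁ n hn h3 hprime, if n % 8 = 1 then 3 else 1, ?_, h₂ n hn hprime⟩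
  split <;> decide

/-- **FAMILY-LEVEL CUSP CRITERION (PROVED modulo the two candidate laws):** under E-an-102 and E-an-103, for
every member `E'_m` (`|m| ≥ 3`) with `L(E'_m,1) ≠ 0` and finite `Ш`, and every modular parametrization whose
lattice is `c·Λ_f` (`X₀`-optimality) with `L*(E'_m) = {∞,0}_f` (the `L`-link), the Manin constant is ODD iff
the cusp value `{∞,0}_f` is a half-unit multiple of `Ω⁺_f` (E-es-55).  [folklore] -/
theorem blindFamily_maninOdd_iff_cuspHalf (hB : BlindFamilyBSDTwo) (hLoc : BlindFamilyLocalTerms)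
    (n : ℤ) (hn : Odd n) (h3 : 3 ≤ |n|) (hprime : Nat.Prime (n ^ 2 + 4).natAbs)
    (hfin : Finite (blindCurve n).sha) (han : (blindCurve n).analyticRank = 0)
    {N : ℕ} [NeZero N] (D : ModularParametrizationData (blindCurve n) N)
    (hopt : ∀ z ∈ D.L.lattice, ∃ w ∈ periodLattice D.f, z = D.c * w)
    (hlink : (blindCurve n).leadingLCoeff = modularSymbol D.f 0) :
    ¬ (2 : ℤ) ∣ D.c ↔
      ∃ a b : ℕ, ¬ 2 ∣ a ∧ ¬ 2 ∣ b ∧ 2 * (b : ℂ) * modularSymbol D.f 0 = (a : ℂ) * (plusPeriod D.f : ℂ) := by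
  haveI := hfin
  haveI : Fact (Nat.Prime (n ^ 2 + 4).natAbs) := ⟨hprime⟩
  obtain ⟨ht, c₂, hc₂, hT⟩ := hLoc n hn h3 hprime
  have hpn : (((n ^ 2 + 4).natAbs : ℕ) : ℤ) = n ^ 2 + 4 := by
    rw [Int.natCast_natAbs]; exact abs_of_pos (by positivity)
  exact blindCurve_maninOdd_iff_cuspHalf_of_bsdTwo hpn hn ht c₂ hc₂ hT (hB n hn hprime han) D hopt hlink


/-! ### The L-link and the Mazur–Tate–Teitelbaum currency (MEMO-an §65 (D′)) -/

/-- **L-link (PROVED from the tree):** in analytic rank `0`, `L*(E) = L(E,1) = {∞,0}_f` for the newform `f`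
of `E` (`leadingLCoeff_eq_of_analyticRank_eq_zero` + `IsNewformOf.modularSymbol_zero_eq_entireLFunction_one`).
[folklore] -/
theorem leadingLCoeff_eq_modularSymbol_zero {W : WeierstrassCurve ℚ} [W.IsElliptic] {N : ℕ} [NeZero N]
    (D : ModularParametrizationData W N) (han : W.analyticRank = 0) :
    W.leadingLCoeff = modularSymbol D.f 0 := by
  rw [leadingLCoeff_eq_of_analyticRank_eq_zero W han]
  exact D.isNewformOf.modularSymbol_zero_eq_entireLFunction_one.symm

/-- **CUSP HALF-UNIT LAW = `[0]⁺_f` IS A HALF-UNIT (PROVED dictionary):** `2b·{∞,0}_f = a·Ω⁺_f` with `a, b` odd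
iff `2b·[0]⁺_f = a` with `a, b` odd, where `[0]⁺_f = ratPlusSymbol f 0 ∈ ℚ` is the Mazur–Tate–Teitelbaum
rational plus symbol (`L(E,1) = [0]⁺_f · Ω⁺_f`, tree `IsNewformOf.entireLFunction_one_eq`), i.e. iff
`v₂([0]⁺_f) = −1`.  [folklore] -/
theorem cuspHalf_iff_ratPlusSymbol_halfUnit {W : WeierstrassCurve ℚ} [W.IsElliptic] {N : ℕ} [NeZero N]
    (D : ModularParametrizationData W N) :
    (∃ a b : ℕ, ¬ 2 ∣ a ∧ ¬ 2 ∣ b ∧ 2 * (b : ℂ) * modularSymbol D.f 0 = (a : ℂ) * (plusPeriod D.f : ℂ)) ↔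
      ∃ a b : ℕ, ¬ 2 ∣ a ∧ ¬ 2 ∣ b ∧ 2 * (b : ℚ) * ratPlusSymbol D.f 0 = a := by
  have hpos : 0 < plusPeriod D.f :=
    IsNewform0.plusPeriod_pos_holds D.isNewformOf.1 D.isNewformOf.coeffField_eq_bot
  have hM : modularSymbol D.f 0 = ((((ratPlusSymbol D.f 0 : ℚ) : ℝ) * plusPeriod D.f : ℝ) : ℂ) := by
    rw [D.isNewformOf.modularSymbol_zero_eq_entireLFunction_one, D.isNewformOf.entireLFunction_one_eq]
  have hΩ0 : (plusPeriod D.f : ℂ) ≠ 0 := by exact_mod_cast hpos.ne'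
  constructor
  · rintro ⟨a, b, ha, hb, e⟩
    refine ⟨a, b, ha, hb, ?_⟩
    rw [hM] at e
    push_cast at e
    have key : ((2 * (b : ℚ) * ratPlusSymbol D.f 0 : ℚ) : ℂ) * (plusPeriod D.f : ℂ) =
        ((a : ℚ) : ℂ) * (plusPeriod D.f : ℂ) := by
      push_cast
      linear_combination e
    exact_mod_cast mul_right_cancel₀ hΩ0 key
  · rintro ⟨a, b, ha, hb, e⟩
    refine ⟨a, b, ha, hb, ?_⟩
    rw [hM]
    have e' : ((2 * (b : ℚ) * ratPlusSymbol D.f 0 : ℚ) : ℂ) = ((a : ℚ) : ℂ) := by rw [e]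
    push_cast at e' ⊢
    linear_combination (plusPeriod D.f : ℂ) * e'

/-- **FAMILY-LEVEL CUSP CRITERION, Mazur–Tate–Teitelbaum form (PROVED modulo E-an-102/103):** for every
member `E'_m` (`|m| ≥ 3`, `L(E'_m,1) ≠ 0`, `Ш` finite) and every `X₀`-optimal parametrization `D`
(`Λ_E ⊆ c·Λ_f`), the Manin constant `D.c` is ODD iff `v₂([0]⁺_f) = −1` — the L-link is discharged by the
tree, no `hlink` hypothesis.  [folklore] -/
theorem blindFamily_maninOdd_iff_ratPlusSymbol (hB : BlindFamilyBSDTwo) (hLoc : BlindFamilyLocalTerms)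
    (n : ℤ) (hn : Odd n) (h3 : 3 ≤ |n|) (hprime : Nat.Prime (n ^ 2 + 4).natAbs)
    (hfin : Finite (blindCurve n).sha) (han : (blindCurve n).analyticRank = 0)
    {N : ℕ} [NeZero N] (D : ModularParametrizationData (blindCurve n) N)
    (hopt : ∀ z ∈ D.L.lattice, ∃ w ∈ periodLattice D.f, z = D.c * w) :
    ¬ (2 : ℤ) ∣ D.c ↔ ∃ a b : ℕ, ¬ 2 ∣ a ∧ ¬ 2 ∣ b ∧ 2 * (b : ℚ) * ratPlusSymbol D.f 0 = a := by
  haveI : Fact (Nat.Prime (n ^ 2 + 4).natAbs) := ⟨hprime⟩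
  have hpn : (((n ^ 2 + 4).natAbs : ℕ) : ℤ) = n ^ 2 + 4 := by
    rw [Int.natCast_natAbs]; exact abs_of_pos (by positivity)
  haveI := isElliptic_blindCurve hpn
  rw [← cuspHalf_iff_ratPlusSymbol_halfUnit D]
  exact blindFamily_maninOdd_iff_cuspHalf hB hLoc n hn h3 hprime hfin han D hopt
    (leadingLCoeff_eq_modularSymbol_zero D han)

/-- **Summit-side corollary, MTT form (PROVED edge):** on a member with `L ≠ 0`, finite `Ш`, the local terms,
an `X₀`-optimal `D` with ODD Manin constant and `v₂([0]⁺_f) = −1`, the `2`-part of BSD holds. [folklore] -/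
theorem blindCurve_bsdTwo_of_maninOdd_of_ratPlusSymbol (hpm : (p : ℤ) = m ^ 2 + 4) (hm : Odd m)
    [Finite (blindCurve m).sha] (htors : (blindCurve m).torsionOrder = 2) (c₂ : ℕ) (hc₂ : ¬ 2 ∣ c₂)
    (hT : (blindCurve m).tamagawaProduct = 2 * c₂) (han : (blindCurve m).analyticRank = 0)
    {N : ℕ} [NeZero N] (D : ModularParametrizationData (blindCurve m) N)
    (hopt : ∀ z ∈ D.L.lattice, ∃ w ∈ periodLattice D.f, z = D.c * w) (hodd : ¬ (2 : ℤ) ∣ D.c)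
    (hα : ∃ a b : ℕ, ¬ 2 ∣ a ∧ ¬ 2 ∣ b ∧ 2 * (b : ℚ) * ratPlusSymbol D.f 0 = a) :
    BSDTwoAdicLead (blindCurve m) := by
  haveI := isElliptic_blindCurve hpm
  exact blindCurve_bsdTwo_of_maninOdd_of_cuspHalf hpm hm htors c₂ hc₂ hT D hopt
    (leadingLCoeff_eq_modularSymbol_zero D han) hodd ((cuspHalf_iff_ratPlusSymbol_halfUnit D).mpr hα)

end BSDTwo
end Summit.BirchSwinnertonDyer.Rank1Residual.ManinAdditive.BlindFamilyDescent

end
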